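import Summits.QuantumFields.YangMills.Theorems.UnitScaleTiltProp7OneFormGreenBlockColumnOfLiftAbs
import Summits.QuantumFields.YangMills.Theorems.UnitScaleTiltProp7OneFormGreenKFreeNumerics
import HarnessLib

/-!
# Route `UnitScaleTilt`, crux K1 «MinimiserStabilityRegPr» (stmt-QuantumFields-19200), EX row `h133` ∕ `norm_G` road N6, (K2)-storey of `G₀ = Δ_a(U₀)⁻¹`:
# **(Gb) — THE BLOCK-SUPPORTED DECAYED SUP ROW OF `G₀` UNDER `Lift`, AND ITS MEMBER-FREE EDITION** (the `hGb` letter of N6 FILE D3 `hGblk_pi_of_blockLetters`)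

Cell `ym3-torus` (HUMAN RULING D-0037; rung R3 = SU(2) YM₃ on T³ — NOT d = 4, NOT infinite volume, NOT a mass gap, NOT Clay).  Width seat `ym3-torus-px16` g14
(`--supports stmt-QuantumFields-19200 --as helper`).  THEOREMS ONLY (0 `def`, 0 `sorry`, default heartbeats); count-neutral.

WHAT.  N4 §3 ✓`Prop7OneFormGreenSupBound.norm_symm_GT_apply_le_of_blockSupport` is the (Gb) row at the MEMBER with DISPLAYED letters: for a source `X` supported on the
bonds of one `L^{K−n}`-block `y` with `‖X b‖ ≤ s`, `‖toL2⁻¹(G₀(toL2 X)) bd‖ ≤ s·A₂·e^{−(min r ¼∕2)·tdist(B bd₋, y)}`, `A₂ = A₂(CkQ + CkD, c₀, ℓ, Θ(γ, C_V, θ_V, r, ε), μ′)`.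
This file is the (Gb) twin of the px16 lineage's (K2-L1) pair ✓`blockColumn_GT_DeltaEtaSlot_of_lift_abs` → ✓`blockColumn_GT_DeltaEtaSlot_kfree`, token for token:
* §1 ★★ `norm_symm_GT_apply_le_of_blockSupport_of_lift_abs` — (Gb) with `PosOnto` ⟸ (γ) + ✓`surjective_Qk_of_regPr`, `hQ` ⟸ ✓`norm_Qk_le_of_regPr`, `hVconj` ⟸
  ✓`hVconj_phaseClass_of_letters`, `hVlow` ⟸ ✓`hVlow_abs_of_lift` (ABSOLUTE `C_V`), `hkQ` ⟸ ✓`hkQ_of_regPr` fed BY NAME (A2i's knit); displayed (VERBATIM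
  ✓`norm_symm_GT_apply_le_of_lift_abs`'s): `n < K`; `RegPr F n K ε₀ U₀`, `0 < ε₀`, three `ε₀`-windows; `Lift`; `0 ≤ a`; (γ) `hco` with `0 < γ`; `hk_D` at `μ′ > r > 0`; `0 < ε ≤ 1`;
  `0 < Θ`; `(32√2ε₀e^{5r})(8e^{3r})·14 < 1`.
* §2 ★★★ `blockSup_GT_DeltaEtaSlot_kfree` — the MEMBER-FREE edition: hypotheses VERBATIM ✓`blockColumn_GT_DeltaEtaSlot_kfree`'s (coupling window `0 ≤ a ≤ a₁(c₀∕cB)ℓ³`, `hk_D`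
  in px10's `C_K·ℓ⁻³·e^{−δ_K·d}` currency, the four budgets + cap), conclusion = N6 FILE D3 `hGblk_pi_of_blockLetters`'s `hGb` binder TEXT with `BV := C_G∕2` member-free
  and `δ₁ := min r ¼∕2` (numerics: ✓`twoA₂_le_kfree` halved, ✓`theta_ge_half_of_budgets`, ✓`thetaV_le_kfree`, ✓`rbudget_le`, ✓`CV_abs_le`, ✓`hsmall_le_half` — nothing new).
HONEST SCOPE.  Re-knits of landed theorems + landed real arithmetic; CONDITIONAL on (γ) `hco`, `hk_D`, `Lift` and the displayed numeric conditions; nothing of `h133`, `norm_G`,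
`hCk`, the EX rows, EX or the crux is proved; no summit is proved by a helper.  Credit: knit pattern = px21 g14's A2i; K-free pattern = px16 g13's D2.

References: T. Bałaban, CMP **99** (1985) 389–434 [Balaban1985BackgroundPropagators] (Thm 3.3 (3.46)–(3.49) pp.398–399, Thm 3.1 (3.42) p.397, (3.21)–(3.27) pp.394–395,
Thm 3.11 p.416, Thm 3.12 p.423).
-/

set_option autoImplicit false

noncomputable section

open scoped Matrix.Norms.L2Operator BigOperators InnerProductSpace ComplexConjugate

namespace Summit.QuantumFields.YangMills.Theorems.Prop7OneFormGreenBlockSupKFree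

open Literature.MathematicalPhysics.QuantumFieldTheory.Balaban1983to89
open Literature.MathematicalPhysics.QuantumFieldTheory.Balaban1983to89.T3ContinuumYM3Torus
open Literature.MathematicalPhysics.QuantumFieldTheory.Balaban1983to89.T3PrintedRegularMinimiser (RegPr)
open B15DeterminingSets (embIter)
open T3SectALandauChart (formComp bgUnits eta eta_pos)
open B9SectCLatticeCarrier (Bond)
open B9Eq311L2Pairing (WL2)
open B11Eq103H1Complex (BondL2K)
open B5Eq118OneStroke (iterBlockOf)
open Summit.QuantumFields.YangMills.Theorems.Prop8Chart (emlIterU)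
open Summit.QuantumFields.YangMills.Theorems.Prop7SectET3Transport (periodsT3 bondEquiv)
open Summit.QuantumFields.YangMills.Theorems.Prop7SectET3HilbertLetters (W₂ frobEquiv toL2 toL2S DL2 DstarL2)
open Summit.QuantumFields.YangMills.Theorems.Prop7SectET3WilsonHessian (DeltaEtaSlot)
open Summit.QuantumFields.YangMills.Theorems.Prop7SectET3GaugeProjector (RS)
open Summit.QuantumFields.YangMills.Theorems.Prop7SectET3CurvedPropagators (laplaceA Qk GT PosOnto)
open Summit.QuantumFields.YangMills.Theorems.Prop7OneFormAgmonPhaseClass (hVconj_phaseClass_of_letters)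
open Summit.QuantumFields.YangMills.Theorems.Prop7QkPenaltyKernelRowOfRegPr (hkQ_of_regPr)
open Summit.QuantumFields.YangMills.Theorems.Prop7QkAdjointSupRowOfRegPr (norm_Qk_le_of_regPr)
open Summit.QuantumFields.YangMills.Theorems.Prop7QkOntoOfRegPr (surjective_Qk_of_regPr)
open Summit.QuantumFields.YangMills.Theorems.Prop7OneFormRemainderFloorOfLift (hVlow_abs_of_lift)
open Summit.QuantumFields.YangMills.Theorems.Prop7OneFormGreenSupBound (norm_symm_GT_apply_le_of_blockSupport)
open Summit.QuantumFields.YangMills.Theorems.Prop7OneFormGreenKFreeNumerics (thetaV_le_kfree twoA₂_le_kfree hsmall_le_half rbudget_le theta_ge_half_of_budgets CV_abs_le)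

variable (F : T3Family) {n K : ℕ} (h : n ≤ K) (c₀ cB : ℝ) [Fact (0 < c₀)] [Fact (0 < cB)]

/-! ## §1 (Gb) under `Lift`, absolute `C_V` -/

/-- ★★ **(Gb) UNDER `Lift` AT `RegPr`, COUPLING-FREE (C_V)**: the block-supported decayed sup row ✓`norm_symm_GT_apply_le_of_blockSupport` (N4 §3) with `PosOnto`, `hQ`,
`hVconj`, `hVlow` (absolute `C_V`), `hkQ` fed by name exactly as ✓`norm_symm_GT_apply_le_of_lift_abs` feeds N4 §2; displayed: `RegPr` + windows, `Lift`, `0 ≤ a`, (γ) `hco`,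
`hk_D`, the numeric `(r, ε)` conditions.  THEN for `X` supported on the bonds of block `y` with `‖X b‖ ≤ s`:
`‖toL2⁻¹(G₀(toL2 X)) bd‖ ≤ s·A₂·e^{−(min r ¼∕2)·tdist(B bd₋, y)}` (`A₂` = N4's constant with the fed letters).  CONDITIONAL on the displayed letters.
[cite: Balaban1985BackgroundPropagators, Thm 3.3 (3.47) p.398, Thm 3.1 (3.42) p.397, (3.46) p.398, Thm 3.12 p.423] -/
theorem norm_symm_GT_apply_le_of_blockSupport_of_lift_abs (hnK : n < K) {ε₀ : ℝ} (hε₀ : 0 < ε₀) (hWε : 10 ^ 12 * (F.L : ℝ) ^ 3 * ε₀ ≤ 1)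
    (hε10 : 10 ^ 10 * (F.L : ℝ) ^ 6 * ε₀ ≤ 1) (hwin : 13 * 10 ^ 14 * (F.L : ℝ) ^ 3 * ε₀ ≤ 1)
    (U₀ : GaugeField (F.P K) 0 (Matrix.specialUnitaryGroup (Fin 2) ℂ)) (hreg : RegPr F n K ε₀ U₀)
    (hlift : ∀ cf : Site (F.P K) (K - n) → Matrix (Fin 2) (Fin 2) ℂ,
        (∀ e : PBond (F.P K) (K - n), cf e.src = ((emlIterU (K - n) (bgUnits F K U₀) e : (Matrix (Fin 2) (Fin 2) ℂ)ˣ) : Matrix (Fin 2) (Fin 2) ℂ) * cf e.tgt *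
          (((emlIterU (K - n) (bgUnits F K U₀) e)⁻¹ : (Matrix (Fin 2) (Fin 2) ℂ)ˣ) : Matrix (Fin 2) (Fin 2) ℂ)) →
        ∃ l₀ : Site (F.P K) 0 → Matrix (Fin 2) (Fin 2) ℂ,
          (∀ b : PBond (F.P K) 0, l₀ b.src = ((bgUnits F K U₀ b : (Matrix (Fin 2) (Fin 2) ℂ)ˣ) : Matrix (Fin 2) (Fin 2) ℂ) * l₀ b.tgt * (((bgUnits F K U₀ b)⁻¹ : (Matrix (Fin 2) (Fin 2) ℂ)ˣ) : Matrix (Fin 2) (Fin 2) ℂ)) ∧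
          ∀ y : Site (F.P K) (K - n), l₀ (embIter (K - n) y) = cf y)
    {a : ℝ} (ha : 0 ≤ a)
    {γ : ℝ} (hγ : 0 < γ) (hco : ∀ v : BondL2K ℂ 3 (periodsT3 F K) c₀ W₂, γ * ‖v‖ ^ 2 ≤ RCLike.re ⟪v, laplaceA F n K h c₀ cB a (DeltaEtaSlot F n K c₀) U₀ v⟫_ℂ)
    {r μ' CkD : ℝ} (hr : 0 < r) (hrμ : r < μ') (hCkD : 0 ≤ CkD)
    (hkD : ∀ (b : PBond (F.P K) 0) (Z : Matrix (Fin 2) (Fin 2) ℂ) (bd : PBond (F.P K) 0),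
      ‖(toL2 F K c₀).symm (DL2 F n K c₀ U₀ (DstarL2 F n K c₀ U₀ (toL2 F K c₀ (Pi.single b Z))
          - RS F n K h c₀ cB U₀ (DstarL2 F n K c₀ U₀ (toL2 F K c₀ (Pi.single b Z))))) bd‖
        ≤ CkD * Real.exp (-(μ' * (Site.tdist (P := F.P K) (iterBlockOf (K - n) b.src) (iterBlockOf (K - n) bd.src) : ℝ))) * ‖Z‖)
    {ε : ℝ} (hε : 0 < ε) (hε1 : ε ≤ 1)
    (hΘ : 0 < ((1 - ε) * γ - ε * ((32 * Real.sqrt 2 * ε₀ * (((F.P K).d : ℝ) * (2 * 3) ^ (F.P K).d)) + (33 / 8 : ℝ) ^ 2 * (600 * (27 / 4 : ℝ) ^ 6)) - 3 * (r ^ 2 * Real.exp (2 * r)) * (1 + 1 / ε)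
            - (a * (2 * Real.sqrt (216 * (Real.exp (r * (((F.P K).d : ℝ) + 1)) - 1) ^ 2 * (cB / (c₀ * ((F.L : ℝ) ^ (K - n)) ^ 3))) * (6 * Real.sqrt (cB / c₀) * Real.sqrt (((F.L : ℝ) ^ (K - n))⁻¹ ^ 3))
                  + 216 * (Real.exp (r * (((F.P K).d : ℝ) + 1)) - 1) ^ 2 * (cB / (c₀ * ((F.L : ℝ) ^ (K - n)) ^ 3)))
              + Real.sqrt 2 * CkD * (r * (F.P K).d * Real.exp (r * (F.P K).d) / min 1 ((μ' - r) / 2))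
                  * (((F.P K).d : ℝ) * ((((F.P K).L : ℝ) ^ (F.P K).d) ^ (K - n)) * (2 * (1 + 1 / (μ' - (r + min 1 ((μ' - r) / 2))))) ^ 3)
              + 32 * Real.sqrt 2 * ε₀ * (((F.P K).d : ℝ) * (2 * 3) ^ (F.P K).d) * (1 + Real.exp (2 * r)))))
    (hsmall : (32 * Real.sqrt 2 * ε₀ * Real.exp (5 * r)) * (8 * Real.exp (3 * r)) * 14 < 1)
    (X : PBond (F.P K) 0 → Matrix (Fin 2) (Fin 2) ℂ) (y : Site (F.P K) (K - n)) (hXy : ∀ b, X b ≠ 0 → iterBlockOf (K - n) b.src = y)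
    {s : ℝ} (hs : 0 ≤ s) (hX : ∀ b, ‖X b‖ ≤ s) (bd : PBond (F.P K) 0) :
    ‖(toL2 F K c₀).symm (GT F n K h c₀ cB a (DeltaEtaSlot F n K c₀) U₀ (toL2 F K c₀ X)) bd‖
      ≤ s * (((Real.sqrt 2 + Real.sqrt 2 * (((2 * a * 5 ^ 2 * (cB / c₀) * ((F.L : ℝ) ^ (K - n))⁻¹ ^ 6 * Real.exp μ') + CkD) * Real.sqrt (((F.P K).d : ℝ) * ((((F.P K).L : ℝ) ^ (F.P K).d) ^ (K - n)) / c₀) * (Real.exp (6 * r) * Real.sqrt (2 * c₀ * (((F.P K).d : ℝ) * ((((F.P K).L : ℝ) ^ (F.P K).d) ^ (K - n)))) / ((1 - ε) * γ - ε * ((32 * Real.sqrt 2 * ε₀ * (((F.P K).d : ℝ) * (2 * 3) ^ (F.P K).d)) + (33 / 8 : ℝ) ^ 2 * (600 * (27 / 4 : ℝ) ^ 6)) - 3 * (r ^ 2 * Real.exp (2 * r)) * (1 + 1 / ε) - ((a * (2 * Real.sqrt (216 * (Real.exp (r * (((F.P K).d : ℝ) + 1)) - 1) ^ 2 * (cB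 / (c₀ * ((F.L : ℝ) ^ (K - n)) ^ 3))) * (6 * Real.sqrt (cB / c₀) * Real.sqrt (((F.L : ℝ) ^ (K - n))⁻¹ ^ 3))
                  + 216 * (Real.exp (r * (((F.P K).d : ℝ) + 1)) - 1) ^ 2 * (cB / (c₀ * ((F.L : ℝ) ^ (K - n)) ^ 3)))
              + Real.sqrt 2 * CkD * (r * (F.P K).d * Real.exp (r * (F.P K).d) / min 1 ((μ' - r) / 2))
                  * (((F.P K).d : ℝ) * ((((F.P K).L : ℝ) ^ (F.P K).d) ^ (K - n)) * (2 * (1 + 1 / (μ' - (r + min 1 ((μ' - r) / 2))))) ^ 3)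
              + 32 * Real.sqrt 2 * ε₀ * (((F.P K).d : ℝ) * (2 * 3) ^ (F.P K).d) * (1 + Real.exp (2 * r)))))) * (2 * (1 + 1 / (μ' - r))) ^ 3)) * (8 * Real.exp (3 * r)) * 14
              + Real.sqrt (3 ^ 3 * 8 / (c₀ * ((F.L : ℝ) ^ (K - n)) ^ 3)) * (Real.sqrt (8 * Real.exp (3 * r) * (2 * (1 + 1 / r)) ^ 3) * (Real.exp (6 * r) * Real.sqrt (2 * c₀ * (((F.P K).d : ℝ) * ((((F.P K).L : ℝ) ^ (F.P K).d) ^ (K - n)))) / ((1 - ε) * γ - ε * ((32 * Real.sqrt 2 * ε₀ * (((F.P K).d : ℝ) * (2 * 3) ^ (F.P K).d)) + (33 / 8 : ℝ) ^ 2 * (600 * (27 / 4 : ℝ) ^ 6)) - 3 * (r ^ 2 * Real.exp (2 * r)) * (1 + 1 / ε) - ((a * (2 * Real.sqrt (216 * (Real.exp (r * (((F.P K).d : ℝ) + 1)) - 1) ^ 2 * (cB / (c₀ * ((F.L : ℝ) ^ (K - n)) ^ 3))) * (6 * Real.sqrt (cB / c₀) * Real.sqrt (((F.L : ℝ) ^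 (K - n))⁻¹ ^ 3))
                  + 216 * (Real.exp (r * (((F.P K).d : ℝ) + 1)) - 1) ^ 2 * (cB / (c₀ * ((F.L : ℝ) ^ (K - n)) ^ 3)))
              + Real.sqrt 2 * CkD * (r * (F.P K).d * Real.exp (r * (F.P K).d) / min 1 ((μ' - r) / 2))
                  * (((F.P K).d : ℝ) * ((((F.P K).L : ℝ) ^ (F.P K).d) ^ (K - n)) * (2 * (1 + 1 / (μ' - (r + min 1 ((μ' - r) / 2))))) ^ 3)
              + 32 * Real.sqrt 2 * ε₀ * (((F.P K).d : ℝ) * (2 * 3) ^ (F.P K).d) * (1 + Real.exp (2 * r))))))))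
            / (1 - (32 * Real.sqrt 2 * ε₀ * Real.exp (5 * r)) * (8 * Real.exp (3 * r)) * 14))
        * Real.exp (-((min r (1 / 4) / 2) * (Site.tdist (iterBlockOf (K - n) bd.src) y : ℝ))) := by
  have hc₀ : 0 < c₀ := Fact.out
  have hcB : 0 < cB := Fact.out
  have hp : PosOnto F n K h c₀ cB a (DeltaEtaSlot F n K c₀) U₀ :=
    ⟨fun x hx => lt_of_lt_of_le (mul_pos hγ (pow_pos (norm_pos_iff.mpr hx) 2)) (hco x), surjective_Qk_of_regPr F h hnK c₀ cB hreg hwin⟩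
  have hQ : ∀ v : BondL2K ℂ 3 (periodsT3 F K) c₀ W₂, ‖Qk F n K h c₀ cB U₀ v‖ ≤ (6 * Real.sqrt (cB / c₀) * Real.sqrt (((F.L : ℝ) ^ (K - n))⁻¹ ^ 3)) * ‖v‖ :=
    fun v => norm_Qk_le_of_regPr F h c₀ cB hε₀ hε10 hWε U₀ hreg v
  have hVconj := hVconj_phaseClass_of_letters F h c₀ cB (a := a) hε₀ hε10 hWε U₀ hreg ha hr.le hrμ hCkD hkD hQ
  have hVlow := hVlow_abs_of_lift F h c₀ cB (a := a) hnK hε₀ hWε U₀ hreg ha hlift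
  have hkQ := hkQ_of_regPr F h c₀ cB hε₀ hε10 hWε U₀ hreg ha (le_of_lt (hr.trans hrμ))
  exact norm_symm_GT_apply_le_of_blockSupport (h := h) (cB := cB) (a := a) hnK.le hε₀.le U₀ hreg hp hr hε hε1 hco hVlow hVconj hΘ hCkD
    (by positivity) hrμ hkD hkQ hsmall X y hXy hs hX bd

/-! ## §2 (Gb) with a member-free constant (the `hGb` letter) -/

/-- ★★★ **(Gb) WITH A MEMBER-FREE CONSTANT — THE `hGb` LETTER OF THE N6 BLOCK-LETTERS EDITION**: at `RegPr F n K ε₀ U₀` with the windows `10¹²L³ε₀ ≤ 1`,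
`10¹⁰L⁶ε₀ ≤ 1`, `13·10¹⁴L³ε₀ ≤ 1`, under `Lift`, for a coupling `0 ≤ a ≤ a₁(c₀∕cB)ℓ³`, (γ) `hco` with `0 < γ`, `hk_D` with constant `C_K·ℓ⁻³` at rate `δ_K > 0`, and `(r, ε)`
under the budgets `0 < r ≤ ¼`, `r ≤ δ_K∕2`, `0 < ε ≤ ⅛`, `ε·C_V¹ ≤ γ∕8`, `r ≤ γε∕48`, `r·T ≤ γ∕16`, `10⁵ε₀ ≤ γ∕16` (VERBATIM ✓`blockColumn_GT_DeltaEtaSlot_kfree`'s):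
`∀ X z, (X b ≠ 0 → B b₋ = z) → ∀ s ≥ 0, (‖X b‖ ≤ s) → ∀ bd, ‖toL2⁻¹(G₀(toL2 X)) bd‖ ≤ s·BV·e^{−(min r ¼∕2)·tdist(B bd₋, z)}` with the MEMBER-FREE
`BV = C_G∕2 = 2·((√2 + √2·(50a₁e^{δ_K} + C_K)·3√2·e^{6r}(2∕γ)·(2(1+2∕δ_K))³)·8e^{3r}·14 + 36·√(8e^{3r}(2(1+1∕r))³)·e^{6r}(2∕γ))` — D3 `hGblk_pi_of_blockLetters`'s `hGb` text at
`δ₁ := min r ¼∕2`.  CONDITIONAL on the displayed letters. [cite: Balaban1985BackgroundPropagators, Thm 3.3 (3.46)–(3.49) pp.398–399, Thm 3.11 p.416, Thm 3.12 p.423] -/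
theorem blockSup_GT_DeltaEtaSlot_kfree (hnK : n < K) {ε₀ : ℝ} (hε₀ : 0 < ε₀) (hWε : 10 ^ 12 * (F.L : ℝ) ^ 3 * ε₀ ≤ 1)
    (hε10 : 10 ^ 10 * (F.L : ℝ) ^ 6 * ε₀ ≤ 1) (hwin : 13 * 10 ^ 14 * (F.L : ℝ) ^ 3 * ε₀ ≤ 1)
    (U₀ : GaugeField (F.P K) 0 (Matrix.specialUnitaryGroup (Fin 2) ℂ)) (hreg : RegPr F n K ε₀ U₀)
    (hlift : ∀ cf : Site (F.P K) (K - n) → Matrix (Fin 2) (Fin 2) ℂ,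
        (∀ e : PBond (F.P K) (K - n), cf e.src = ((emlIterU (K - n) (bgUnits F K U₀) e : (Matrix (Fin 2) (Fin 2) ℂ)ˣ) : Matrix (Fin 2) (Fin 2) ℂ) * cf e.tgt *
          (((emlIterU (K - n) (bgUnits F K U₀) e)⁻¹ : (Matrix (Fin 2) (Fin 2) ℂ)ˣ) : Matrix (Fin 2) (Fin 2) ℂ)) →
        ∃ l₀ : Site (F.P K) 0 → Matrix (Fin 2) (Fin 2) ℂ,
          (∀ b : PBond (F.P K) 0, l₀ b.src = ((bgUnits F K U₀ b : (Matrix (Fin 2) (Fin 2) ℂ)ˣ) : Matrix (Fin 2) (Fin 2) ℂ) * l₀ b.tgt * (((bgUnits F K U₀ b)⁻¹ : (Matrix (Fin 2) (Fin 2) ℂ)ˣ) : Matrix (Fin 2) (Fin 2) ℂ)) ∧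
          ∀ y : Site (F.P K) (K - n), l₀ (embIter (K - n) y) = cf y)
    {a a₁ : ℝ} (ha : 0 ≤ a) (ha₁ : a ≤ a₁ * (c₀ / cB) * ((F.L : ℝ) ^ (K - n)) ^ 3)
    {γ : ℝ} (hγ : 0 < γ) (hco : ∀ v : BondL2K ℂ 3 (periodsT3 F K) c₀ W₂, γ * ‖v‖ ^ 2 ≤ RCLike.re ⟪v, laplaceA F n K h c₀ cB a (DeltaEtaSlot F n K c₀) U₀ v⟫_ℂ)
    {CK δK : ℝ} (hCK : 0 ≤ CK) (hδK : 0 < δK)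
    (hkD : ∀ (b : PBond (F.P K) 0) (Z : Matrix (Fin 2) (Fin 2) ℂ) (bd : PBond (F.P K) 0),
      ‖(toL2 F K c₀).symm (DL2 F n K c₀ U₀ (DstarL2 F n K c₀ U₀ (toL2 F K c₀ (Pi.single b Z))
          - RS F n K h c₀ cB U₀ (DstarL2 F n K c₀ U₀ (toL2 F K c₀ (Pi.single b Z))))) bd‖
        ≤ CK * ((F.L : ℝ) ^ (K - n))⁻¹ ^ 3 * Real.exp (-(δK * (Site.tdist (P := F.P K) (iterBlockOf (K - n) b.src) (iterBlockOf (K - n) bd.src) : ℝ))) * ‖Z‖)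
    {r ε : ℝ} (hr : 0 < r) (hr4 : r ≤ 1 / 4) (hrδ : r ≤ δK / 2) (hε : 0 < ε) (hε8 : ε ≤ 1 / 8)
    (hεC : ε * (32 * Real.sqrt 2 * 648 + (33 / 8 : ℝ) ^ 2 * (600 * (27 / 4 : ℝ) ^ 6)) ≤ γ / 8) (hrγ : r ≤ γ * ε / 48)
    (hrT : r * (5000 * a₁ + 27 * Real.sqrt 2 * CK * (2 * (1 + 4 / δK)) ^ 3 / min 1 (δK / 4)) ≤ γ / 16) (hαγ : 10 ^ 5 * ε₀ ≤ γ / 16) :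
    ∀ (X : PBond (F.P K) 0 → Matrix (Fin 2) (Fin 2) ℂ) (z : Site (F.P K) (K - n)), (∀ b, X b ≠ 0 → iterBlockOf (K - n) b.src = z) →
      ∀ s : ℝ, 0 ≤ s → (∀ b, ‖X b‖ ≤ s) →
        ∀ bd : PBond (F.P K) 0, ‖(toL2 F K c₀).symm (GT F n K h c₀ cB a (DeltaEtaSlot F n K c₀) U₀ (toL2 F K c₀ X)) bd‖
          ≤ s * (2 * ((Real.sqrt 2 + Real.sqrt 2 * ((50 * a₁ * Real.exp δK + CK) * (3 * Real.sqrt 2) * (Real.exp (6 * r) * (2 / γ)) * (2 * (1 + 2 / δK)) ^ 3))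
                    * (8 * Real.exp (3 * r)) * 14
                  + 36 * (Real.sqrt (8 * Real.exp (3 * r) * (2 * (1 + 1 / r)) ^ 3) * (Real.exp (6 * r) * (2 / γ)))))
            * Real.exp (-((min r (1 / 4) / 2) * (Site.tdist (P := F.P K) (iterBlockOf (K - n) bd.src) z : ℝ))) := by
  intro X z hXz s hs hX bd
  have hc₀ : 0 < c₀ := Fact.out
  have hcB : 0 < cB := Fact.out
  have hd : (F.P K).d = 3 := rfl
  have hL2 : (2 : ℝ) ≤ F.L := by exact_mod_cast F.hL.2
  have hLr : (1 : ℝ) ≤ F.L := le_trans one_le_two hL2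
  have hL3 : (1 : ℝ) ≤ (F.L : ℝ) ^ 3 := one_le_pow₀ hLr
  have hε5 : ε₀ ≤ (10 : ℝ)⁻¹ ^ 5 := by
    have h1 : 10 ^ 12 * ε₀ ≤ 10 ^ 12 * (F.L : ℝ) ^ 3 * ε₀ := by nlinarith [hε₀.le]
    have h2 : 10 ^ 12 * ε₀ ≤ 1 := h1.trans hWε
    rw [inv_pow]
    rw [le_inv_comm₀ hε₀ (by positivity)]
    calc (10 : ℝ) ^ 5 ≤ 10 ^ 12 := by norm_num
      _ ≤ ε₀⁻¹ := by rw [le_inv_comm₀ (by positivity) hε₀]; exact (le_div_iff₀' (by positivity)).mpr (by linarith) |>.trans (le_of_eq (one_div _))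
  have hε1 : ε₀ ≤ 1 := hε5.trans (by norm_num)
  -- the four budgets ⟹ `Θ ≥ γ∕2`
  have hθ := thetaV_le_kfree hd hLr (K - n) hc₀ hcB ha ha₁ hCK hδK hr hr4 hrδ hε₀.le
  have hθ8 := hθ.trans (show r * (5000 * a₁ + 27 * Real.sqrt 2 * CK * (2 * (1 + 4 / δK)) ^ 3 / min 1 (δK / 4)) + 10 ^ 5 * ε₀ ≤ γ / 8 by linarith)
  have hεC' := (mul_le_mul_of_nonneg_left (CV_abs_le hd hε1) hε.le).trans hεC
  have hR := (rbudget_le hγ.le hr hr4 hε (by linarith) hrγ).trans (show γ / 16 ≤ γ / 8 by linarith [hγ.le])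
  have hΘ := theta_ge_half_of_budgets hγ.le hε8 hεC' hR hθ8
  have hS := hsmall_le_half hr4 hε₀.le hε5
  have hsup := norm_symm_GT_apply_le_of_blockSupport_of_lift_abs F h c₀ cB hnK hε₀ hWε hε10 hwin U₀ hreg hlift ha hγ hco hr (show r < δK by linarith)
    (by positivity : 0 ≤ CK * ((F.L : ℝ) ^ (K - n))⁻¹ ^ 3) hkD hε (by linarith) (lt_of_lt_of_le (by positivity) hΘ) (lt_of_le_of_lt hS (by norm_num)) X z hXz hs hX bd
  have hA := twoA₂_le_kfree hd hLr (K - n) hc₀ hcB ha ha₁ hCK hδK hr hr4 hrδ hγ hΘ hε₀.le hε5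
  have h22 : ∀ x : ℝ, 4 * x = 2 * (2 * x) := fun x => by ring
  rw [h22] at hA
  exact hsup.trans (mul_le_mul_of_nonneg_right (mul_le_mul_of_nonneg_left (le_of_mul_le_mul_left hA two_pos) hs) (Real.exp_pos _).le)

end Summit.QuantumFields.YangMills.Theorems.Prop7OneFormGreenBlockSupKFree

end
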